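import Summits.QuantumFields.YangMills.Theorems.BalabanUVNodesN15KingModelComplexLinkPerturbation
import Summits.QuantumFields.YangMills.Theorems.BalabanUVNodesN15KingModelComplexLinkSpectrum
import Summits.QuantumFields.YangMills.Theorems.BalabanUVNodesN15KingModelCovariantSpectralBounds
import HarnessLib
/-!
# BalabanUVNodes ∕ N15 — THE KING-MODEL RUNG (PART Ϛ-l): THE `ℓ² → ℓ²` OPERATOR NORM ON THE COMPLEX WINDOW BY THE SCHUR TEST — `‖G_{U,V}‖ ≤ 1∕(m² − 2(d+1)cε)`, `‖T_{U,V}‖ ≤ 2(d+1)(1+ε)c`,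
# `‖T_{δU,δV}‖ ≤ 2(d+1)c·sup‖δ‖`, and the operator-norm Lipschitz bound `‖G_{U,V} − G_{U′,V′}‖ ≤ 2(d+1)c·δ∕(m² − 2(d+1)cε)²` (the non-Hermitian substitute for PART Ͱ-f's `‖G_U‖ ≤ 1∕m²`)
# (Track A, DAG node N15 = NE2; FAN-OUT v1.1 §N15 s3 «KING-MODEL RUNG … + what the curved case adds»; count-neutral)
HONEST FRAMING.  Count-neutral (cell `pub-ymgap`, seat `pub-ymgap-dag-n15-e` g43; `--supports stmt-QuantumFields-27247 --as helper` = K3ᴬ, KEY MAP v3).  One finite torus at fixed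
spacing; King's `A = 0` model, FINE covariance layer only; nothing of Bałaban's (3.42) ∕ Thm 3.4 for `G(U)` asserted; nothing continuum ∕ ℝ⁴ ∕ OS ∕ Clay; NOT a node discharge.
WHAT IS DECIDED.  [Balaban1985BackgroundPropagators] Thm 3.4 p.400 «The extended operators satisfy all the inequalities of Theorems 3.1–3.3 correspondingly» — among them Thm 3.1's «inequalities in L²-norms»
(3.46) p.398 l.12–16 (the sup norms themselves are DEFINED in (3.39) p.397).  PART Ͱ-f proved `‖G_U‖_{ℓ²→ℓ²} ≤ 1∕m²` at unitary `U` from the spectrum of the Hermitian `M_U`; off the unitary slice `M_{U,V}` is not normal, and the substitute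
is the SCHUR TEST on the block kernel dominated by King's symmetric shifted kernel (rows AND columns sum to `1∕m′²`, Ϟ-s + Ν-a):
* §1 ★★ **`l2_opNorm_le_sqrt_of_blk`** — THE BLOCK SCHUR TEST: `‖A_{xy}‖_{op} ≤ a(x,y)`, `Σ_ya(x,y) ≤ R`, `Σ_xa(x,y) ≤ C` ⟹ `‖A‖_{ℓ²(T×n)→ℓ²(T×n)} ≤ √(RC)` (weighted Cauchy–Schwarz on the fibre
  decomposition Ϛ-g `norm_fib_mulVec_le_sum`, Ͱ-f `sum_norm_fib_sq`); `l2_opNorm_le_of_blk_symm` (`R = C ⟹ ≤ R`);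
* §2 ★★★ **`l2_opNorm_cxLapF_inv_le`** — ON THE WINDOW `‖U(b)‖, ‖V(b)‖ ≤ 1+ε`, `2(d+1)cε < m²`: `‖G_{U,V}‖_{ℓ²→ℓ²} ≤ 1∕(m² − 2(d+1)cε)` (Ϛ-b domination + the shifted sum rule on rows and, by
  `lapF_inv_comm`, on columns) — at `ε = 0` on unitary fields this is Ͱ-f's `l2_opNorm_covLapF_inv_le` (not restated);
* §3 ★★ `l2_opNorm_cxHop_le` (`‖T_{U,V}‖ ≤ 2(d+1)(1+ε)c`), ★★ `l2_opNorm_cxHop_le_of_sup` (`‖T_{δU,δV}‖ ≤ 2(d+1)c·δ` for `‖δU(b)‖, ‖δV(b)‖ ≤ δ`: `(U,V) ↦ M_{U,V}` is `2(d+1)c`-LIPSCHITZ IN OPERATOR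
  NORM), `l2_opNorm_cxLapF_sub_le`;
* §4 ★★★ **`l2_opNorm_cxLapF_inv_sub_inv_le`** — OPERATOR-NORM LIPSCHITZ BOUND ON THE WINDOW: `‖G_{U,V} − G_{U′,V′}‖ ≤ 2(d+1)c·δ∕m′⁴` for two window pairs at sup distance `δ` (second resolvent
  identity Ϛ-f + `norm_mul_le`); ★★ `l2_opNorm_cxLapF_inv_sub_unitary_le` (about a unitary `U₀`: `‖G_{U,V} − G_{U₀}‖ ≤ 2(d+1)c·ε∕m′⁴` — print's «small perturbations» in OPERATOR norm).
PRIOR TREE ART (by name): Ϛ-b (`l2_opNorm_blk_cxLapF_inv_le`, `l2_opNorm_blk_cxHop_le`, `shifted_*`, `unitary_mem_window`), Ϛ-f (`cxLapF_inv_sub_inv`, `lapF_inv_shifted_le_inv_mass`), Ϛ-a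
(`blk_cxHop`, `cxHop_sub`, `cxLapF_sub_cxLapF`, `cxLapF_adjoint`), Ϛ-g (`norm_fib_mulVec_le_sum`), Ͱ-b (`fib`, `lapF_inv_entry_nonneg`), Ͱ-f (`sum_norm_fib_sq`), Ͱ-k (`kingHop_nonneg`, `sum_kingHop_row`), Ϟ-s
(`sum_lapF_inv_eq_inv_mass`), Ν-a (`lapF_inv_comm`), Mathlib (`Finset.sum_sq_le_sum_mul_sum_of_sq_le_mul`, `Matrix.cstar_norm_def`, `Matrix.toEuclideanCLM_toLp`, `ContinuousLinearMap.opNorm_le_bound`,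
`le_of_pow_le_pow_left₀`, `WithLp.toLp_sum`).  Dedup (rg at filing): basename 0 files; needles `l2_opNorm_le_sqrt_of_blk|l2_opNorm_cxLapF_inv_le\\b|l2_opNorm_cxHop_le\\b` 0 tree files; v1 dry-run `dedup.landed` ×2 (a local copy of Ϛ-g `norm_fib_mulVec_le_sum` and an `ε = 0` corollary equal to Ͱ-f `l2_opNorm_covLapF_inv_le`) — both DELETED, the landed declarations are used ∕ cited.  Locators:
[Balaban1985BackgroundPropagators] Thm 3.4 p.400, (3.46) p.398 l.12–16 (L²-norm inequalities; (3.39) p.397 = the norms' definition), (3.42) p.397, p.400 l.10–12; [King1986] (4.4) p.670, (2.17) p.653.  v1.1 (doc-only, ERRATUM-Ϛ1 after ref-I g52 FYI I.22690-ish): the v1.0 locator «(3.39) p.397» for the `ℓ²` bounds named the DEFINITION of the sup norms; the L²-norm inequalities of Thm 3.1 are (3.46) p.398 — locators corrected, statements and proofs byte-identical.  0 `sorry`, 0 `def`.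
-/

noncomputable section
open scoped BigOperators ComplexConjugate ComplexOrder Matrix.Norms.L2Operator
open Finset Matrix WithLp

namespace Summit.QuantumFields.YangMills.BalabanUVNodes.N15KingModelRung.Covariant

open Literature.MathematicalPhysics.QuantumFieldTheory.LatticeDiamagneticInequality (Hopping blk)
open Literature.MathematicalPhysics.QuantumFieldTheory.Balaban1983to89.B5Prop11Plancherel (Tor unitVec)
open Literature.MathematicalPhysics.QuantumFieldTheory.King1986.Torus (lapF)
open Summit.QuantumFields.YangMills.BalabanUVNodes.N15KingModelRung.TorusSpectral (sum_lapF_inv_eq_inv_mass lapF_inv_comm)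

variable {d : ℕ} (K : Fin (d + 1) → ℕ) [hK : ∀ μ, NeZero (K μ)]
variable {𝕜 : Type*} [RCLike 𝕜] {n : Type*} [Fintype n] [DecidableEq n] {c m2 ε : ℝ}

/-! ## §1 The block Schur test -/

/-- ★★ **THE BLOCK SCHUR TEST**: if `‖A_{xy}‖_{op} ≤ a(x,y)`, every row sum `Σ_ya(x,y) ≤ R` and every column sum `Σ_xa(x,y) ≤ C`, then `‖A‖_{ℓ²(T×n)→ℓ²(T×n)} ≤ √(R·C)`.
[cite: Balaban1985BackgroundPropagators, (3.46) p.398; King1986, (4.4) p.670] -/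
theorem l2_opNorm_le_sqrt_of_blk {A : Matrix (Tor K × n) (Tor K × n) 𝕜} {a : Tor K → Tor K → ℝ} (ha : ∀ x y, ‖blk A x y‖ ≤ a x y)
    {R C : ℝ} (hR : ∀ x, ∑ y, a x y ≤ R) (hC : ∀ y, ∑ x, a x y ≤ C) : ‖A‖ ≤ Real.sqrt (R * C) := by
  have ha0 : ∀ x y, 0 ≤ a x y := fun x y => (norm_nonneg _).trans (ha x y)
  have hR0 : 0 ≤ R := (Finset.sum_nonneg fun y _ => ha0 0 y).trans (hR 0)
  have hC0 : 0 ≤ C := by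
    obtain ⟨y⟩ : Nonempty (Tor K) := ⟨0⟩
    exact (Finset.sum_nonneg fun x _ => ha0 x y).trans (hC y)
  rw [Matrix.cstar_norm_def]
  refine ContinuousLinearMap.opNorm_le_bound _ (Real.sqrt_nonneg _) fun w => ?_
  have hw : w = toLp 2 (ofLp w) := rfl
  rw [hw, Matrix.toEuclideanCLM_toLp]
  set v : Tor K × n → 𝕜 := ofLp w with hv
  -- the squared bound `‖Av‖² ≤ R·C·‖v‖²`
  have hx : ∀ x, ‖fib K (A *ᵥ v) x‖ ^ 2 ≤ R * ∑ y, a x y * ‖fib K v y‖ ^ 2 := fun x => by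
    have h1 := norm_fib_mulVec_le_sum K A v x
    have h2 : (∑ y, ‖blk A x y‖ * ‖fib K v y‖) ^ 2 ≤ (∑ y, a x y * ‖fib K v y‖) ^ 2 :=
      pow_le_pow_left₀ (Finset.sum_nonneg fun y _ => mul_nonneg (norm_nonneg _) (norm_nonneg _))
        (Finset.sum_le_sum fun y _ => mul_le_mul_of_nonneg_right (ha x y) (norm_nonneg _)) 2
    have h3 : (∑ y, a x y * ‖fib K v y‖) ^ 2 ≤ (∑ y, a x y) * ∑ y, a x y * ‖fib K v y‖ ^ 2 :=
      Finset.sum_sq_le_sum_mul_sum_of_sq_le_mul Finset.univ (fun y _ => ha0 x y) (fun y _ => mul_nonneg (ha0 x y) (sq_nonneg _))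
        (fun y _ => by rw [mul_pow]; exact le_of_eq (by ring))
    calc ‖fib K (A *ᵥ v) x‖ ^ 2 ≤ (∑ y, ‖blk A x y‖ * ‖fib K v y‖) ^ 2 := pow_le_pow_left₀ (norm_nonneg _) h1 2
      _ ≤ (∑ y, a x y) * ∑ y, a x y * ‖fib K v y‖ ^ 2 := h2.trans h3
      _ ≤ R * ∑ y, a x y * ‖fib K v y‖ ^ 2 :=
          mul_le_mul_of_nonneg_right (hR x) (Finset.sum_nonneg fun y _ => mul_nonneg (ha0 x y) (sq_nonneg _))
  have hsq : ‖(toLp 2 (A *ᵥ v) : EuclideanSpace 𝕜 (Tor K × n))‖ ^ 2 ≤ (Real.sqrt (R * C) * ‖(toLp 2 v : EuclideanSpace 𝕜 (Tor K × n))‖) ^ 2 := by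
    rw [← sum_norm_fib_sq K (A *ᵥ v), mul_pow, Real.sq_sqrt (mul_nonneg hR0 hC0), ← sum_norm_fib_sq K v]
    calc ∑ x, ‖fib K (A *ᵥ v) x‖ ^ 2 ≤ ∑ x, R * ∑ y, a x y * ‖fib K v y‖ ^ 2 := Finset.sum_le_sum fun x _ => hx x
      _ = R * ∑ y, (∑ x, a x y) * ‖fib K v y‖ ^ 2 := by
          rw [← Finset.mul_sum, Finset.sum_comm]
          congr 1
          exact Finset.sum_congr rfl fun y _ => by rw [Finset.sum_mul]
      _ ≤ R * ∑ y, C * ‖fib K v y‖ ^ 2 :=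
          mul_le_mul_of_nonneg_left (Finset.sum_le_sum fun y _ => mul_le_mul_of_nonneg_right (hC y) (sq_nonneg _)) hR0
      _ = R * C * ∑ y, ‖fib K v y‖ ^ 2 := by rw [← Finset.mul_sum, mul_assoc]
  have hw' : (toLp 2 v : EuclideanSpace 𝕜 (Tor K × n)) = w := rfl
  rw [hw'] at hsq
  exact le_of_pow_le_pow_left₀ two_ne_zero (mul_nonneg (Real.sqrt_nonneg _) (norm_nonneg _)) hsq

/-- THE SYMMETRIC CASE: equal row and column bounds `R` give `‖A‖ ≤ R`. [folklore] -/
theorem l2_opNorm_le_of_blk_symm {A : Matrix (Tor K × n) (Tor K × n) 𝕜} {a : Tor K → Tor K → ℝ} (ha : ∀ x y, ‖blk A x y‖ ≤ a x y)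
    {R : ℝ} (hR : ∀ x, ∑ y, a x y ≤ R) (hC : ∀ y, ∑ x, a x y ≤ R) : ‖A‖ ≤ R := by
  have hR0 : 0 ≤ R := (Finset.sum_nonneg fun y _ => (norm_nonneg _).trans (ha 0 y)).trans (hR 0)
  have h := l2_opNorm_le_sqrt_of_blk K ha hR hC
  rwa [Real.sqrt_mul_self hR0] at h

/-! ## §2 The covariance on the window -/

/-- ★★★ **THE `ℓ² → ℓ²` BOUND ON THE COMPLEX WINDOW**: for `c ≥ 0`, `m² > 0`, `0 ≤ ε`, `2(d+1)cε < m²` and `‖U(b)‖, ‖V(b)‖ ≤ 1+ε`: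
`‖G_{U,V}‖_{ℓ²(T×n)→ℓ²(T×n)} ≤ 1∕(m² − 2(d+1)cε)` — King's shifted kernel has rows AND columns summing to `1∕m′²`.  [B9] Thm 3.1's L²-norm inequality (3.46) for the analytic extension, in the model.
[cite: Balaban1985BackgroundPropagators, Thm 3.4 p.400, (3.46) p.398; King1986, (4.4) p.670, (2.17) p.653] -/
theorem l2_opNorm_cxLapF_inv_le (hc : 0 ≤ c) (hm : 0 < m2) (hε : 0 ≤ ε) (hwin : 2 * ((d : ℝ) + 1) * c * ε < m2)
    {U V : Tor K × Fin (d + 1) → Matrix n n 𝕜} (hU : ∀ b, ‖U b‖ ≤ 1 + ε) (hV : ∀ b, ‖V b‖ ≤ 1 + ε) :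
    ‖(cxLapF K c m2 U V)⁻¹‖ ≤ (m2 - 2 * ((d : ℝ) + 1) * c * ε)⁻¹ := by
  have hc' := shifted_weight_nonneg hc hε
  have hm' := shifted_mass_pos hwin
  refine l2_opNorm_le_of_blk_symm K (fun x y => l2_opNorm_blk_cxLapF_inv_le K hc hm hε hwin hU hV x y) (fun x => ?_) (fun y => ?_)
  · exact le_of_eq (sum_lapF_inv_eq_inv_mass K hc' hm' x)
  · rw [← sum_lapF_inv_eq_inv_mass K hc' hm' y]
    exact Finset.sum_le_sum fun x _ => le_of_eq (lapF_inv_comm K _ _ x y)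

/-! ## §3 The hopping matrix and the operator-norm Lipschitz constant of `(U,V) ↦ M_{U,V}` -/

/-- ★★ `‖T_{U,V}‖_{ℓ²→ℓ²} ≤ 2(d+1)(1+ε)c` on the polydisc of radius `1+ε` (King's shifted hopping matrix has row and column sums `2(d+1)(1+ε)c`).
[cite: Balaban1985BackgroundPropagators, (3.23) p.394; King1986, (4.4) p.670] -/
theorem l2_opNorm_cxHop_le (hc : 0 ≤ c) {U V : Tor K × Fin (d + 1) → Matrix n n 𝕜} (hU : ∀ b, ‖U b‖ ≤ 1 + ε) (hV : ∀ b, ‖V b‖ ≤ 1 + ε) :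
    ‖cxHop K c U V‖ ≤ 2 * ((d : ℝ) + 1) * ((1 + ε) * c) := by
  have hsymm : ∀ x y, kingHop K ((1 + ε) * c) x y = kingHop K ((1 + ε) * c) y x := fun x y => by
    simp only [kingHop]
    congr 1
    rw [← Equiv.sum_comp (Equiv.refl _)]
    refine Finset.sum_congr rfl fun μ _ => ?_
    simp only [Equiv.refl_apply]
    have h1 : (y = x + unitVec K μ) ↔ (x = y - unitVec K μ) := by constructor <;> intro h <;> simp [h]
    have h2 : (y = x - unitVec K μ) ↔ (x = y + unitVec K μ) := by constructor <;> intro h <;> simp [h]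
    simp only [h1, h2]
    exact add_comm _ _
  refine l2_opNorm_le_of_blk_symm K (fun x y => l2_opNorm_blk_cxHop_le K hc hU hV x y) (fun x => le_of_eq (sum_kingHop_row K _ x)) (fun y => ?_)
  rw [← sum_kingHop_row K ((1 + ε) * c) y]
  exact Finset.sum_le_sum fun x _ => le_of_eq (hsymm x y)

/-- ★★ **`(U,V) ↦ T_{U,V}` IS `2(d+1)c`-LIPSCHITZ IN OPERATOR NORM**: `‖δU(b)‖, ‖δV(b)‖ ≤ δ` on all bonds ⟹ `‖T_{δU,δV}‖ ≤ 2(d+1)c·δ` (`c ≥ 0`).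
[cite: Balaban1985BackgroundPropagators, (3.53) p.400; King1986, (4.4) p.670] -/
theorem l2_opNorm_cxHop_le_of_sup (hc : 0 ≤ c) {δU δV : Tor K × Fin (d + 1) → Matrix n n 𝕜} {δ : ℝ} (hδU : ∀ b, ‖δU b‖ ≤ δ) (hδV : ∀ b, ‖δV b‖ ≤ δ) :
    ‖cxHop K c δU δV‖ ≤ 2 * ((d : ℝ) + 1) * c * δ := by
  have hδ0 : 0 ≤ δ := (norm_nonneg _).trans (hδU ((0 : Tor K), 0))
  -- `δ = (1 + (δ − 1))`: the fields lie in the polydisc of radius `δ`, so the hopping bound of Ϛ-b applies with weight `δ·c`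
  have hU' : ∀ b, ‖δU b‖ ≤ 1 + (δ - 1) := fun b => by rw [add_sub_cancel]; exact hδU b
  have hV' : ∀ b, ‖δV b‖ ≤ 1 + (δ - 1) := fun b => by rw [add_sub_cancel]; exact hδV b
  have hblk : ∀ x y, ‖blk (cxHop K c δU δV) x y‖ ≤ kingHop K (δ * c) x y := fun x y => by
    have h := l2_opNorm_blk_cxHop_le K hc hU' hV' x y
    rwa [add_sub_cancel] at h
  have hsymm : ∀ x y, kingHop K (δ * c) x y = kingHop K (δ * c) y x := fun x y => by
    simp only [kingHop]
    congr 1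
    refine Finset.sum_congr rfl fun μ _ => ?_
    have h1 : (y = x + unitVec K μ) ↔ (x = y - unitVec K μ) := by constructor <;> intro h <;> simp [h]
    have h2 : (y = x - unitVec K μ) ↔ (x = y + unitVec K μ) := by constructor <;> intro h <;> simp [h]
    simp only [h1, h2]
    exact add_comm _ _
  refine (l2_opNorm_le_of_blk_symm K hblk (fun x => le_of_eq (sum_kingHop_row K _ x)) (fun y => ?_)).trans (le_of_eq (by ring))
  rw [← sum_kingHop_row K (δ * c) y]
  exact Finset.sum_le_sum fun x _ => le_of_eq (hsymm x y)

omit [Fintype n] in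
/-- `M_{U,V} − M_{U′,V′} = −T_{U−U′,V−V′}`. [folklore] -/
theorem cxLapF_sub_cxLapF_eq_neg_cxHop (c m2 : ℝ) (U U' V V' : Tor K × Fin (d + 1) → Matrix n n 𝕜) :
    cxLapF K c m2 U V - cxLapF K c m2 U' V' = -cxHop K c (U - U') (V - V') := by
  rw [cxLapF_sub_cxLapF, cxHop_sub, neg_sub]

/-- ★ `‖M_{U,V} − M_{U′,V′}‖ ≤ 2(d+1)c·δ` for fields at sup distance `δ`: `(U,V) ↦ M_{U,V}` is `2(d+1)c`-Lipschitz in operator norm, everywhere. [cite: Balaban1985BackgroundPropagators, (3.53) p.400] -/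
theorem l2_opNorm_cxLapF_sub_le (hc : 0 ≤ c) (m2 : ℝ) {U U' V V' : Tor K × Fin (d + 1) → Matrix n n 𝕜} {δ : ℝ}
    (hdU : ∀ b, ‖U b - U' b‖ ≤ δ) (hdV : ∀ b, ‖V b - V' b‖ ≤ δ) :
    ‖cxLapF K c m2 U V - cxLapF K c m2 U' V'‖ ≤ 2 * ((d : ℝ) + 1) * c * δ := by
  rw [cxLapF_sub_cxLapF_eq_neg_cxHop, norm_neg]
  exact l2_opNorm_cxHop_le_of_sup K hc (fun b => hdU b) (fun b => hdV b)

/-! ## §4 Operator-norm Lipschitz bounds for the covariance on the window -/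

/-- ★★★ **OPERATOR-NORM LIPSCHITZ BOUND ON THE WINDOW**: for two pairs in the window at sup distance `δ`,
`‖G_{U,V} − G_{U′,V′}‖_{ℓ²→ℓ²} ≤ 2(d+1)c·δ∕(m² − 2(d+1)cε)²` (second resolvent identity, `‖G‖, ‖G′‖ ≤ 1∕m′²`, `‖T_δ‖ ≤ 2(d+1)cδ`).
[cite: Balaban1985BackgroundPropagators, p.400 l.10–12, (3.57) p.401, (3.46) p.398] -/
theorem l2_opNorm_cxLapF_inv_sub_inv_le (hc : 0 ≤ c) (hm : 0 < m2) (hε : 0 ≤ ε) (hwin : 2 * ((d : ℝ) + 1) * c * ε < m2)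
    {U V U' V' : Tor K × Fin (d + 1) → Matrix n n 𝕜} (hU : ∀ b, ‖U b‖ ≤ 1 + ε) (hV : ∀ b, ‖V b‖ ≤ 1 + ε)
    (hU' : ∀ b, ‖U' b‖ ≤ 1 + ε) (hV' : ∀ b, ‖V' b‖ ≤ 1 + ε) {δ : ℝ} (hdU : ∀ b, ‖U b - U' b‖ ≤ δ) (hdV : ∀ b, ‖V b - V' b‖ ≤ δ) :
    ‖(cxLapF K c m2 U V)⁻¹ - (cxLapF K c m2 U' V')⁻¹‖
      ≤ 2 * ((d : ℝ) + 1) * c * δ * ((m2 - 2 * ((d : ℝ) + 1) * c * ε)⁻¹ * (m2 - 2 * ((d : ℝ) + 1) * c * ε)⁻¹) := by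
  have hm' := shifted_mass_pos hwin
  have hG := l2_opNorm_cxLapF_inv_le K hc hm hε hwin hU hV
  have hG' := l2_opNorm_cxLapF_inv_le K hc hm hε hwin hU' hV'
  have hT := l2_opNorm_cxHop_le_of_sup K hc (fun b => hdU b) (fun b => hdV b)
  have hδ0 : 0 ≤ δ := (norm_nonneg _).trans (hdU ((0 : Tor K), 0))
  rw [cxLapF_inv_sub_inv K hc hm hε hwin hU hV hU' hV']
  calc ‖(cxLapF K c m2 U V)⁻¹ * cxHop K c (U - U') (V - V') * (cxLapF K c m2 U' V')⁻¹‖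
      ≤ ‖(cxLapF K c m2 U V)⁻¹‖ * ‖cxHop K c (U - U') (V - V')‖ * ‖(cxLapF K c m2 U' V')⁻¹‖ :=
        (norm_mul_le _ _).trans (mul_le_mul_of_nonneg_right (norm_mul_le _ _) (norm_nonneg _))
    _ ≤ (m2 - 2 * ((d : ℝ) + 1) * c * ε)⁻¹ * (2 * ((d : ℝ) + 1) * c * δ) * (m2 - 2 * ((d : ℝ) + 1) * c * ε)⁻¹ := by
        refine mul_le_mul (mul_le_mul hG hT (norm_nonneg _) (inv_nonneg.mpr hm'.le)) hG' (norm_nonneg _) ?_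
        exact mul_nonneg (inv_nonneg.mpr hm'.le) (by positivity)
    _ = 2 * ((d : ℝ) + 1) * c * δ * ((m2 - 2 * ((d : ℝ) + 1) * c * ε)⁻¹ * (m2 - 2 * ((d : ℝ) + 1) * c * ε)⁻¹) := by ring

/-- ★★ **PRINT's «SMALL PERTURBATIONS OF THE OPERATORS DEPENDING ON U ONLY», IN OPERATOR NORM**: for a unitary `U₀` and a two-sided field within `ε` of `(U₀, U₀^*)` bondwise
(`2(d+1)cε < m²`): `‖G_{U,V} − G_{U₀}‖_{ℓ²→ℓ²} ≤ 2(d+1)c·ε∕(m² − 2(d+1)cε)²`. [cite: Balaban1985BackgroundPropagators, p.400 l.10–12, Thm 3.4 p.400, (3.46) p.398] -/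
theorem l2_opNorm_cxLapF_inv_sub_unitary_le (hc : 0 ≤ c) (hm : 0 < m2) (hε : 0 ≤ ε) (hwin : 2 * ((d : ℝ) + 1) * c * ε < m2)
    {U₀ U V : Tor K × Fin (d + 1) → Matrix n n 𝕜} (hU₀ : ∀ b, U₀ b ∈ Matrix.unitaryGroup n 𝕜)
    (hU : ∀ b, ‖U b - U₀ b‖ ≤ ε) (hV : ∀ b, ‖V b - (U₀ b)ᴴ‖ ≤ ε) :
    ‖(cxLapF K c m2 U V)⁻¹ - (covLapF K c m2 U₀)⁻¹‖
      ≤ 2 * ((d : ℝ) + 1) * c * ε * ((m2 - 2 * ((d : ℝ) + 1) * c * ε)⁻¹ * (m2 - 2 * ((d : ℝ) + 1) * c * ε)⁻¹) := by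
  have hU1 : ∀ b, ‖U b‖ ≤ 1 + ε := fun b => by
    have h := norm_add_le (U₀ b) (U b - U₀ b)
    rw [add_sub_cancel] at h
    exact h.trans (add_le_add (l2_opNorm_of_mem_unitaryGroup_le (hU₀ b)) (hU b))
  have hV1 : ∀ b, ‖V b‖ ≤ 1 + ε := fun b => by
    have h := norm_add_le ((U₀ b)ᴴ) (V b - (U₀ b)ᴴ)
    rw [add_sub_cancel] at h
    refine h.trans (add_le_add ?_ (hV b))
    rw [Matrix.l2_opNorm_conjTranspose]; exact l2_opNorm_of_mem_unitaryGroup_le (hU₀ b)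
  have hU₀1 : ∀ b, ‖U₀ b‖ ≤ 1 + ε := fun b => ((unitary_mem_window K hU₀).1 b).trans (by linarith)
  have hU₀2 : ∀ b, ‖(U₀ b)ᴴ‖ ≤ 1 + ε := fun b => ((unitary_mem_window K hU₀).2 b).trans (by linarith)
  rw [← cxLapF_adjoint]
  exact l2_opNorm_cxLapF_inv_sub_inv_le K hc hm hε hwin hU1 hV1 hU₀1 hU₀2 hU hV

end Summit.QuantumFields.YangMills.BalabanUVNodes.N15KingModelRung.Covariant

end
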